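import Summits.RiemannHypothesis.RiemannHypothesis.Theorems.GroundBartaEvenWinsBeyondArchPhantomCertGamma
import Summits.RiemannHypothesis.RiemannHypothesis.Theorems.GroundBartaEvenWinsBeyondArchPhantomRipples
import Literature.NumberTheory.LFunctions.WeilTwoPrimeCertificate
import HarnessLib

/-!
# RiemannHypothesis / GroundBarta machinery — PHANTOM CERTIFICATES (2/3): the format `WeilCert23X`

Helper file (`--supports stmt-RiemannHypothesis-18085`; infrastructure for the Weil-positivity ladder), RH-free, axioms
standard.  Seat rh-explicit-weil-1 (memo `run/shared/lean/pub/rh-explicit/rh-explicit-weil-1/WEIL1-SIZELAW.md`).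

`WeilCert23X` = the two-prime moment certificate `WeilCert23` (`WeilTwoPrimeCertificate.lean`: archimedean format `WeilCert` +
dyadic exponent + integer-checked two-prime cells at a level `wL₀` + support `b` + claimed scaled moment table) + a BOOSTED tail
level `wL` + a lattice-ripple chain `xcells` minorising a phantom `P = ripplesVal rs` on `[0, T]`.  Its checker `check` runs the
OLD cell checker at `wL₀` (so every landed two-prime cell and every moment fact is reusable verbatim), the lattice-ripple chain
checker, the admissibility `2b ≤ x_r` of every phantom frequency (the phantom is then invisible on `C(b)`,
`…PhantomRipples.lean`), and the scalar / moment-table / block checks of `WeilCert23` with `κ` computed from the boosted level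
`wL` and the combined minorant `γ_X` (`…PhantomCertGamma.lean`).  The level beyond `T`, `∀ |t| ≥ T, wL ≤ w₂₃(t) + P(t)`, is NOT
integer-checked here: it is the hypothesis `hlevel` of the soundness theorem (file 3/3), to be discharged by a separate level
certificate (torus / Fejér–Riesz bound of the ripple polynomial).

This file: the structure, `nuQ` / `checkNu` / `nuPrimeAbs` / `kappaExact` / `kappaQ` / `checkScalars` / `checkRipples` / `check`,
the unpacking lemmas, admissibility `two_mul_b_le_abs_rippleFreq`, the exact matrix `pmQexact` with its tolerance and cast
lemmas, and Step B of the reduction (`arch_lower_bound`: `wL·2π‖g‖₂² − ∫|ĝ|²γ_X ≤ ∫|ĝ|² w₂₃` through the phantom identity).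
Everything here is proved; no named facts.
-/

set_option linter.dupNamespace false

noncomputable section

open Complex Finset MeasureTheory Set Filter
open scoped Real Topology ComplexConjugate BigOperators

namespace Summit.RiemannHypothesis.RiemannHypothesis.Theorems.EvenWinsBeyondArch

open Literature.NumberTheory.LFunctions

open Literature.Analysis.ValidatedNumerics.Numerics
open Literature.Analysis.SpecialFunctions

/-- A two-prime moment certificate WITH PHANTOM RIPPLES for `E₂₃ ≥ 0` on `C(b)`: the fields of `WeilCert23` (cells at the
low level `base.wL = wL₀`), the boosted level `wL`, the lattice-ripple chain `xcells` and the phantom ripple list `rs`. [folklore] -/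
structure WeilCert23X where
  /-- parameters, rounding, change of basis and PSD factors (format of `WeilCert`; `base.wL` is the LOW level `wL₀`) -/
  base : WeilCert
  /-- the dyadic exponent of the cell end points -/
  j : ℕ
  /-- tolerance bits of the claimed moment table -/
  pnu : ℕ
  /-- the cells of the two-prime minorant on `[0, T]` (checked at level `wL₀`) -/
  cells : List TPDCell
  /-- the support half-length of the target cone (`tsupport g ⊆ [-b, b]`, `b ≤ a₀`) -/
  b : ℚ
  /-- the claimed table of SCALED total moments `nuScale · ν_q`, `q ≤ 2N` -/
  nuData : List ℚ
  /-- the boosted tail level (justified by the level hypothesis for `w₂₃ + P` beyond `T`) -/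
  wL : ℚ
  /-- the cells of the phantom minorant on `[0, T]` -/
  xcells : List XTCell
  /-- the phantom ripples `(j, k, A)`: `P(t) = Σ A cos(t (j log 2 + k log 3))` -/
  rs : List (ℤ × ℤ × ℚ)

namespace WeilCert23X

variable (c : WeilCert23X)

/-- The scaled total moments `ν_q = a₀^q ∫ γ_X(t) t^q dt` (`= a₀^q · 2·momentX q` for even `q`). [folklore] -/
def nuQ (q : ℕ) : ℚ := c.base.a0 ^ q * (2 * momentX c.base.wL c.wL c.base.T c.cells c.xcells q)

/-- Table of claimed moments. [folklore] -/
def nuTab : List ℚ := c.nuData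

/-- Entry `q` of the claimed table is `nuScale · ν_q` up to `2^{-pnu}`. [folklore] -/
def checkNuAt (q : ℕ) : Bool := decide (|getV c.nuData q - nuScale * c.nuQ q| ≤ 1 / 2 ^ c.pnu)

/-- The claimed moment table is correct at the even indices `q ≤ 2N`. [folklore] -/
def checkNu : Bool := allBelow (c.base.N + 1) fun i ↦ c.checkNuAt (2 * i)

/-- `ν'_abs`: the `|γ_X|`-moment bound of the Taylor remainder on the frequency side. [folklore] -/
def nuPrimeAbs : ℚ :=
  2 * (c.base.a0 ^ (c.base.N + 1) * (2 * absMomentX c.base.wL c.wL c.base.T c.cells c.xcells (c.base.N + 1))) /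
    (c.base.N + 1).factorial

/-- The sup bound of `|γ_X|`. [folklore] -/
def bnd : ℚ := bndX c.base.wL c.wL c.cells c.xcells

/-- `κ_exact`: the boosted level minus `log π`, minus the price of `1/(2π)` against the signed `γ_X`, minus the Taylor /
rounding remainders. [folklore] -/
def kappaExact : ℚ :=
  c.wL - logPiHi20 - 7 * (invTwoPiHi20 - invTwoPiLo20) * c.bnd -
    2 * c.base.a0 * (c.base.etaP + 5 * invTwoPiHi20 * c.nuPrimeAbs +
      ((c.base.N : ℚ) + 1) ^ 2 * (1 / 2 ^ c.base.pg + invTwoPiHi / 2 ^ c.pnu))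

/-- `κ = rd(κ_exact)`. [folklore] -/
def kappaQ : ℚ := ratRd c.base.pg c.kappaExact

/-- Scalar side conditions (as `WeilCert23.checkScalars`, with the phantom `κ`). [folklore] -/
def checkScalars : Bool :=
  decide (1 ≤ c.j) && decide (0 < c.b) && decide (c.b ≤ c.base.a0) && decide (c.base.a0 ≤ 1) &&
    decide (0 < c.base.T) && decide (2 * c.base.a0 * c.base.T ≤ (c.base.N : ℚ) + 2) &&
    decide (2 * (c.base.a0 * c.base.T) ^ (c.base.N + 1) / (c.base.N + 1).factorial ≤ 1) &&
    decide (c.base.N + 1 = 2 * c.base.nb) && decide (0 ≤ c.kappaQ)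

/-- Admissibility of the phantom: every claimed frequency enclosure has `2b ≤ xlo ≤ x` (engine). [folklore] -/
def checkRipples : Bool :=
  c.xcells.all fun xc ↦ xc.claims.all fun r ↦ decide (2 * c.b ≤ r.xlo) && decide (r.xlo ≤ r.freqFI.loQ)

/-- **The checker** (everything except the tail level of `w₂₃ + P`, which is the soundness theorem's hypothesis). [folklore] -/
def check : Bool :=
  checkCells₂₃ c.base.prec c.j c.base.wL c.base.T c.base.mwT c.cells && checkXCells c.rs c.base.T c.xcells &&
    c.checkRipples && c.checkScalars && c.checkNu &&
    c.base.checkBlockK c.nuTab c.kappaQ 0 && c.base.checkBlockK c.nuTab c.kappaQ 1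

variable {c}

/-- Unpacking `check`. [folklore] -/
theorem checkX_spec (h : c.check = true) :
    checkCells₂₃ c.base.prec c.j c.base.wL c.base.T c.base.mwT c.cells = true ∧
      checkXCells c.rs c.base.T c.xcells = true ∧ c.checkRipples = true ∧ c.checkScalars = true ∧ c.checkNu = true ∧
      c.base.checkBlockK c.nuTab c.kappaQ 0 = true ∧ c.base.checkBlockK c.nuTab c.kappaQ 1 = true := by
  unfold check at h
  simp only [Bool.and_eq_true] at h
  exact ⟨h.1.1.1.1.1.1, h.1.1.1.1.1.2, h.1.1.1.1.2, h.1.1.1.2, h.1.1.2, h.1.2, h.2⟩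

/-- Unpacking `checkScalars`. [folklore] -/
theorem scalarsX_spec (h : c.checkScalars = true) :
    0 < c.b ∧ 1 ≤ c.j ∧ c.b ≤ c.base.a0 ∧ c.base.a0 ≤ 1 ∧ 0 < c.base.T ∧
      2 * c.base.a0 * c.base.T ≤ (c.base.N : ℚ) + 2 ∧
      2 * (c.base.a0 * c.base.T) ^ (c.base.N + 1) / (c.base.N + 1).factorial ≤ 1 ∧
      c.base.N + 1 = 2 * c.base.nb ∧ 0 ≤ c.kappaQ := by
  unfold checkScalars at h
  simp only [Bool.and_eq_true, decide_eq_true_eq] at h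
  exact ⟨h.1.1.1.1.1.1.1.2, h.1.1.1.1.1.1.1.1, h.1.1.1.1.1.1.2, h.1.1.1.1.1.2, h.1.1.1.1.2, h.1.1.1.2,
    h.1.1.2, h.1.2, h.2⟩

/-- The table of moments agrees with `nuScale · nuQ` at even `q ≤ 2N` up to `2^{-pnu}`. [folklore] -/
theorem abs_getV_nuTabX_sub_le (h : c.checkNu = true) {q : ℕ} (he : q % 2 = 0) (hq : q ≤ 2 * c.base.N) :
    |getV c.nuTab q - nuScale * c.nuQ q| ≤ 1 / 2 ^ c.pnu := by
  unfold checkNu at h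
  have := of_allBelow h (k := q / 2) (by omega)
  unfold checkNuAt at this
  rw [show 2 * (q / 2) = q by omega] at this
  simpa [nuTab] using this

/-! ### Admissibility of the phantom -/

/-- The frequency of a claim is the ripple frequency of its data. [folklore] -/
theorem XRip.freq_eq_rippleFreq (r : XRip) : r.freq = rippleFreq (r.j, r.k, r.A) := rfl

/-- **Every phantom frequency is `≥ 2b`** (so `P` is invisible on `C(b)`). [folklore] -/
theorem two_mul_b_le_abs_rippleFreq (hX : XCellsOK c.rs c.base.T c.xcells) (hT : 0 < c.base.T)
    (hr : c.checkRipples = true) : ∀ r ∈ c.rs, 2 * (c.b : ℝ) ≤ |rippleFreq r| := by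
  intro r hmem
  -- the chain is nonempty
  obtain ⟨xc, hxc⟩ : ∃ xc, xc ∈ c.xcells := by
    cases hcs : c.xcells with
    | nil =>
      have hch := hX.chain
      rw [hcs] at hch
      simp only [checkChainX, decide_eq_true_eq] at hch
      exact absurd hch (ne_of_lt hT)
    | cons xc _ => exact ⟨xc, by simp⟩
  have hrs := hX.ripples xc hxc
  rw [← hrs] at hmem
  unfold XTCell.ripples at hmem
  obtain ⟨cl, hcl, hcle⟩ := List.mem_map.1 hmem
  unfold checkRipples at hr
  simp only [List.all_eq_true, Bool.and_eq_true, decide_eq_true_eq] at hr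
  obtain ⟨h1, h2⟩ := hr xc hxc cl hcl
  have h3 : (cl.xlo : ℝ) ≤ cl.freq := le_trans (by exact_mod_cast h2) (FI.loQ_le cl.freq_mem_freqFI)
  rw [← hcle, ← XRip.freq_eq_rippleFreq]
  have h1' : 2 * (c.b : ℝ) ≤ cl.xlo := by exact_mod_cast h1
  exact le_trans (by linarith) (le_abs_self _)

/-- The phantom as a `phantomRipple` list. [folklore] -/
theorem ripplesVal_eq_phantomRipple (rs : List (ℤ × ℤ × ℚ)) (t : ℝ) :
    ripplesVal rs t = phantomRipple (rs.map fun r ↦ (((r.2.2 : ℚ) : ℝ), rippleFreq r)) t := by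
  unfold ripplesVal phantomRipple
  rw [List.map_map]
  rfl

/-! ### Step B: the minorant (through the phantom identity) -/

variable {g : ℝ → ℂ}

/-- **Minorant bound.** `wL · 2π ‖g‖₂² − ∫ ‖ĝ‖² γ_X ≤ ∫ ‖ĝ(1/2+it)‖² w₂₃(t) dt` on `C(b)`: `wL − γ_X ≤ w₂₃ + P` pointwise and
`∫ ‖ĝ‖² P = 0`. [folklore] -/
theorem arch_lower_bound (h23 : CellsOK₂₃ c.base.wL c.base.T c.cells) (hX : XCellsOK c.rs c.base.T c.xcells)
    (hadm : ∀ r ∈ c.rs, 2 * (c.b : ℝ) ≤ |rippleFreq r|)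
    (hlevel : ∀ t : ℝ, (c.base.T : ℝ) ≤ |t| → (c.wL : ℝ) ≤ weilTwoPrimeWeight t + ripplesVal c.rs t)
    (hg : IsWeilTest g) (hsupp : tsupport g ⊆ Icc (-(c.b : ℝ)) c.b) :
    (c.wL : ℝ) * (2 * π * weilNorm2Sq g) -
        ∫ t : ℝ, ‖weilMellin g (1 / 2 + t * I)‖ ^ 2 * gammaX c.base.wL c.wL c.base.T c.cells c.xcells t ≤
      ∫ t : ℝ, ‖weilMellin g (1 / 2 + t * I)‖ ^ 2 * weilTwoPrimeWeight t := by
  set γ := gammaX c.base.wL c.wL c.base.T c.cells c.xcells with hγdef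
  obtain ⟨B, hB0, hB⟩ := exists_abs_gammaX_le (wL := c.wL) h23 hX
  set σ : ℝ → ℝ := fun t ↦ (c.wL : ℝ) - γ t with hσ
  have hσm : Measurable σ := measurable_const.sub (measurable_gammaX _ _ _ _ _)
  have hσb : ∀ t, |σ t| ≤ (|(c.wL : ℝ)| + B) + 0 * t ^ 2 := fun t ↦ by
    rw [hσ, zero_mul, add_zero]
    exact (abs_sub _ _).trans (add_le_add le_rfl (hB t))
  have hle : ∀ t, σ t ≤ weilTwoPrimeWeight t + ripplesVal c.rs t := fun t ↦
    level_sub_gammaX_le h23 hX hlevel t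
  have hi1 : Integrable fun t : ℝ ↦ ‖weilMellin g (1 / 2 + t * I)‖ ^ 2 * σ t :=
    integrable_norm_sq_weilMellin_mul hg hσm (by positivity) le_rfl hσb
  -- the phantom-modified weight and its integral
  set ps : List (ℝ × ℝ) := c.rs.map fun r ↦ (((r.2.2 : ℚ) : ℝ), rippleFreq r) with hps
  have hps2 : ∀ p ∈ ps, 2 * (c.b : ℝ) ≤ |p.2| := by
    intro p hp
    rw [hps] at hp
    obtain ⟨r, hr, rfl⟩ := List.mem_map.1 hp
    exact hadm r hr
  have ewP : ∀ t, weilTwoPrimeWeight t + ripplesVal c.rs t = weilTwoPrimeWeight t + phantomRipple ps t := fun t ↦ by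
    rw [ripplesVal_eq_phantomRipple]
  have hiw := integrable_norm_sq_weilMellin_mul_weilTwoPrimeWeight hg
  have hiP := integrable_norm_sq_weilMellin_mul_phantomRipple hg ps
  have hi2 : Integrable fun t : ℝ ↦ ‖weilMellin g (1 / 2 + t * I)‖ ^ 2 * (weilTwoPrimeWeight t + ripplesVal c.rs t) := by
    have e : (fun t : ℝ ↦ ‖weilMellin g (1 / 2 + t * I)‖ ^ 2 * (weilTwoPrimeWeight t + ripplesVal c.rs t)) =
        fun t : ℝ ↦ ‖weilMellin g (1 / 2 + t * I)‖ ^ 2 * weilTwoPrimeWeight t +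
          ‖weilMellin g (1 / 2 + t * I)‖ ^ 2 * phantomRipple ps t := by
      funext t; rw [ewP]; ring
    rw [e]; exact hiw.add hiP
  have hphantom : ∫ t : ℝ, ‖weilMellin g (1 / 2 + t * I)‖ ^ 2 * (weilTwoPrimeWeight t + ripplesVal c.rs t) =
      ∫ t : ℝ, ‖weilMellin g (1 / 2 + t * I)‖ ^ 2 * weilTwoPrimeWeight t := by
    have := integral_norm_sq_weilMellin_mul_add_phantomRipple hg hsupp hiw hps2
    simp_rw [ewP]
    exact this
  have h := integral_mono hi1 hi2 fun t ↦ mul_le_mul_of_nonneg_left (hle t) (sq_nonneg _)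
  rw [hphantom] at h
  refine le_trans (le_of_eq ?_) h
  have hj1 := integrable_norm_sq_weilMellin_half_line hg
  have hj2 : Integrable fun t : ℝ ↦ ‖weilMellin g (1 / 2 + t * I)‖ ^ 2 * γ t :=
    integrable_norm_sq_weilMellin_mul hg (measurable_gammaX _ _ _ _ _) hB0 le_rfl (B := 0)
      (fun t ↦ by simpa using hB t)
  have e : (fun t : ℝ ↦ ‖weilMellin g (1 / 2 + t * I)‖ ^ 2 * σ t) = fun t : ℝ ↦
      (c.wL : ℝ) * ‖weilMellin g (1 / 2 + t * I)‖ ^ 2 - ‖weilMellin g (1 / 2 + t * I)‖ ^ 2 * γ t := by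
    funext t; rw [hσ]; ring
  rw [e, integral_sub (hj1.const_mul _) hj2, integral_const_mul, integral_norm_sq_weilMellin_half_line hg]

/-! ### The exact matrix and its tolerance -/

/-- The exact rational matrix `Sym − invTwoPiHi · Ĝ(nuScale · ν)`. [folklore] -/
def pmQexact (c : WeilCert23X) (k l : ℕ) : ℚ :=
  if k % 2 = l % 2 then
    (-1 : ℚ) ^ k * 2 * c.base.tauQ k * c.base.tauQ l -
      invTwoPiHi * ((-1 : ℚ) ^ k * (-1 : ℚ) ^ ((k + l) / 2) * (nuScale * c.nuQ (k + l)) /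
        (k.factorial * l.factorial))
  else 0

/-- Table tolerance: `|pmQ ν̃ k l − pmQexact k l| ≤ invTwoPiHi · 2^{-pnu}` for `k, l ≤ N`. [folklore] -/
theorem abs_pmQ_sub_pmQexactX_le (hnu : c.checkNu = true) {k l : ℕ} (hl : l < c.base.N + 1) (hk : k < c.base.N + 1) :
    |c.base.pmQ c.nuTab k l - pmQexact c k l| ≤ invTwoPiHi * (1 / 2 ^ c.pnu) := by
  have hq6 : (0 : ℚ) ≤ invTwoPiHi := by unfold invTwoPiHi piLo; norm_num
  unfold WeilCert.pmQ pmQexact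
  by_cases hkl : k % 2 = l % 2
  · have htab := abs_getV_nuTabX_sub_le hnu (q := k + l) (by omega) (by omega)
    rw [if_pos hkl, if_pos hkl]
    have hf : (0 : ℚ) < (k.factorial : ℚ) * (l.factorial : ℚ) := by positivity
    have hff : (1 : ℚ) ≤ (k.factorial : ℚ) * (l.factorial : ℚ) := by
      have h1 : (1 : ℚ) ≤ k.factorial := by exact_mod_cast Nat.one_le_iff_ne_zero.2 (Nat.factorial_ne_zero k)
      have h2 : (1 : ℚ) ≤ l.factorial := by exact_mod_cast Nat.one_le_iff_ne_zero.2 (Nat.factorial_ne_zero l)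
      nlinarith
    have e : (-1 : ℚ) ^ k * 2 * c.base.tauQ k * c.base.tauQ l -
        invTwoPiHi * ((-1 : ℚ) ^ k * (-1 : ℚ) ^ ((k + l) / 2) * getV c.nuTab (k + l) /
          (k.factorial * l.factorial)) -
        ((-1 : ℚ) ^ k * 2 * c.base.tauQ k * c.base.tauQ l -
          invTwoPiHi * ((-1 : ℚ) ^ k * (-1 : ℚ) ^ ((k + l) / 2) * (nuScale * c.nuQ (k + l)) /
            (k.factorial * l.factorial))) =
        -(invTwoPiHi * ((-1 : ℚ) ^ k * (-1 : ℚ) ^ ((k + l) / 2)) / (k.factorial * l.factorial)) *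
          (getV c.nuTab (k + l) - nuScale * c.nuQ (k + l)) := by
      field_simp
      ring
    rw [e, abs_mul, abs_neg]
    have hsgn : |invTwoPiHi * ((-1 : ℚ) ^ k * (-1 : ℚ) ^ ((k + l) / 2)) / (k.factorial * l.factorial)| ≤
        invTwoPiHi := by
      rw [abs_div, abs_mul, abs_mul, abs_pow, abs_pow, abs_neg, abs_one, one_pow, one_pow, mul_one,
        abs_of_nonneg hq6, abs_of_pos hf, mul_one]
      exact div_le_self hq6 hff
    exact mul_le_mul hsgn htab (abs_nonneg _) hq6
  · rw [if_neg hkl, if_neg hkl, sub_self, abs_zero]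
    positivity

/-- The matrix `Ĝ` of the frequency side. [folklore] -/
def gHat (c : WeilCert23X) (k l : ℕ) : ℝ :=
  if k % 2 = l % 2 then
    (-1 : ℝ) ^ k * (-1) ^ ((k + l) / 2) * ((c.nuQ (k + l) : ℚ) : ℝ) / (k.factorial * l.factorial)
  else 0

/-- Entry identity for the exact matrix: `(pmQexact k l : ℝ) = Sym_{kl} − q₂₀ Ĝ_{kl}`. [folklore] -/
theorem pmQexactX_cast (k l : ℕ) :
    ((pmQexact c k l : ℚ) : ℝ) =
      (if k % 2 = l % 2 then
        2 * (-1 : ℝ) ^ k * (((c.base.a0 : ℝ) / 2) ^ k / k.factorial) * (((c.base.a0 : ℝ) / 2) ^ l / l.factorial)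
        else 0) -
      ((invTwoPiHi20 : ℚ) : ℝ) * gHat c k l := by
  unfold pmQexact gHat
  by_cases hkl : k % 2 = l % 2
  · rw [if_pos hkl, if_pos hkl, if_pos hkl, ← invTwoPiHi_mul_nuScale]
    push_cast
    rw [WeilCert.tauQ_cast, WeilCert.tauQ_cast]
    ring
  · rw [if_neg hkl, if_neg hkl, if_neg hkl]
    all_goals simp

/-- `ν_q = a₀^q ∫ γ_X(t) t^q dt` for even `q`. [folklore] -/
theorem nuQ_eq_integral (h23 : CellsOK₂₃ c.base.wL c.base.T c.cells) (hX : XCellsOK c.rs c.base.T c.xcells) {q : ℕ}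
    (hq : Even q) :
    ((c.nuQ q : ℚ) : ℝ) = (c.base.a0 : ℝ) ^ q * ∫ t, gammaX c.base.wL c.wL c.base.T c.cells c.xcells t * t ^ q := by
  rw [(integral_gammaX_pow h23 hX q).2, if_pos hq]
  unfold nuQ; push_cast; ring

/-! ### Glue for per-fact verification of the moment table (certificate builders) -/

/-- `checkNuAt q` from the two landed moment facts (psi chain at `wL₀`, phantom chain) and one small decision. [folklore] -/
theorem checkNuAt_of_facts {q : ℕ} {m₁ m₂ : ℚ} (h₁ : cellsMomentQ₂₃ c.base.wL c.cells q = m₁) (h₂ : xCellsMomentQ c.xcells q = m₂)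
    (h : decide (|getV c.nuData q - nuScale * (c.base.a0 ^ q * (2 * (m₁ + (c.wL - c.base.wL) * (c.base.T ^ (q + 1) / (q + 1)) - m₂)))| ≤
      1 / 2 ^ c.pnu) = true) : c.checkNuAt q = true := by
  unfold checkNuAt nuQ momentX
  rw [h₁, h₂]
  exact h

/-- `checkNu` from the per-index facts `checkNuAt (2i) = true`, `i ≤ N`. [folklore] -/
theorem checkNu_of_forall (h : ∀ i < c.base.N + 1, c.checkNuAt (2 * i) = true) : c.checkNu = true := by
  unfold checkNu
  exact WeilCert2.allBelow_of_forall h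

end WeilCert23X

end Summit.RiemannHypothesis.RiemannHypothesis.Theorems.EvenWinsBeyondArch

end
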